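import Summits.BirchSwinnertonDyer.Rank1Residual.X12.O11.RamifiedStrictDescentAtThreeLocal
import Summits.BirchSwinnertonDyer.Rank1Residual.X11b.BDPRouteLocalKernelAtPPadic
import HarnessLib

/-!
# O11 at `p = 3`: the LOCAL KERNEL AT `𝔭` of the torsion-allowing control (regime T) is FINITE,
# of order at most `#W(ℚ₃)[3^∞] · #W'(ℚ₃)[3^∞] = #W_K(K_𝔭)[3^∞]`
# (cell `bsd-print-cfram`, seat p3 g3; planner ASK 19:02:57Z «finiteness DISCHARGER» for ty2's T package
# `RamifiedStrictDescentAtThreeRegimeT.lean` (p559111), binder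
# `hfin𝔭 : Finite (localKer κ.kerSubgroup ((W.baseChange K).geomPrimaryTorsion 3) 𝔭)`;
# item of record `PrintCFram.LocalThreeTorsionBSDThree` = stmt-BirchSwinnertonDyer-20699)

HONEST FRAMING (cell `bsd-print-cfram`, HOME `run/shared/lean/pub/bsd-print-cfram/`): THEOREMS ONLY (no
definition, no named fact, no axiom, no `sorry`); nothing about BSD is asserted or booked; regime T of the
`p = 3` slice of K12r stays OPEN. In regime T the binder (A𝔭)₃ «`W(ℚ₃)[3] = 0 ∧ W'(ℚ₃)[3] = 0`» FAILS, so
Greenberg's local kernel `ker r_𝔭 = ker (H¹(K_𝔭, W[3^∞]) → H¹(K^ac_{∞,𝔭}, W[3^∞]))` at the ramified prime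
`𝔭 = (√−3)` is no longer trivial; ty2's torsion-allowing control displays it through
`controlDefectAtThree` and binds ONLY its finiteness. This file DISCHARGES that binder for EVERY
`3`-frame and EVERY `ℤ₃`-extension `κ` (anticyclotomic or not), with the bound of record:

* §1 `finite_primaryComponent_adicCompletion_of_twist` — quadratic descent of `p`-primary torsion along
  `K_𝔭 = ℚ_p(√−p)` (any odd `p`, `d_K = −p`, `W' = C • W^{(−p)}` globally minimal):
  `W_K(K_𝔭)[p^∞]` is finite and `#W_K(K_𝔭)[p^∞] = #W(ℚ_p)[p^∞] · #W'(ℚ_p)[p^∞]` (Silverman *AEC* Ex. 10.16,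
  tree `card_primaryComponent_point_baseChange_quadratic_of_odd'`; `E(ℚ_p)[p^∞]` finite by the formal
  group, tree `finite_primaryComponent_point_padic`) — the identity behind ty2's `noPTorsion_adicCompletion_of_twist`,
  now WITHOUT the two vanishing hypotheses;
* §1 `finite_localKer_and_natCard_le_of_twist` — hence (Greenberg's Lemma 3.3 in kernel form at EVERY
  place, tree `AcSelmer.natCard_localKer_le_natCard_primaryComponent`: `#ker r_v ≤ #E(K_v)[p^∞]`, no
  hypothesis on `κ` or on the reduction) `ker r_𝔭` is finite and `#ker r_𝔭 ≤ #W(ℚ_p)[p^∞] · #W'(ℚ_p)[p^∞]`;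
* §2 `finite_localKer_geomPrimaryTorsion_three_of_isFrameThree` (THE DISCHARGER, the binder verbatim) and
  `natCard_localKer_three_le_of_isFrameThree` (the bound) at a `3`-frame `IsFrameThree W K 𝔭 W' C`.

Numerics of record (ty3 PART H; p3 STEP-0 census kit j287629): on regime T, `#W(ℚ₃)[3^∞] · #W'(ℚ₃)[3^∞] =
#W_K(K_𝔭)[3^∞] ∈ {3, 9}`; along the local anticyclotomic tower `W_K(K^ac_{n,𝔭})[3^∞] ⊆ W[3]` for all `n`
(p3 census memo, LEMMA 1: `W[𝔭³]` rational forces `μ₉`, absent from the dihedral `K^ac_{n,𝔭}`), so the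
true order of `ker r_𝔭 = B_𝔭/(γ_𝔭 − 1)B_𝔭` is `#B_𝔭^{γ_𝔭} = #W_K(K_𝔭)[3^∞]` (finite `B_𝔭`; equality is NOT
claimed here). beyond-print: NO (Greenberg LNM 1716 §3 + Silverman Ex. 10.16).
References: [GreenbergLNM1716] §3 Lemma 3.3 and its proof (pp. 73–75); [SilvermanAEC2009] Ex. 10.16,
Prop. VII.6.3; [Castella2018] proof of Thm. 2.3 (the factor `#H⁰(K_𝔭, E[p^∞])`);
[BurungaleKobayashiNakamuraOta2026] (3.16), Assumption 3.1 (1) (arXiv:2608.06879 §3.4; shape only).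
-/

noncomputable section

open scoped Classical

open WeierstrassCurve NumberField IsDedekindDomain Field
  Literature.NumberTheory.EllipticCurves
  Literature.NumberTheory.EllipticCurves.GreenbergSelmer
  Literature.NumberTheory.EllipticCurves.Rank1Residual
  Literature.NumberTheory.GaloisRepresentations
  Summit.BirchSwinnertonDyer.Rank1Residual
  Summit.BirchSwinnertonDyer.Rank1Residual.X11b
  Summit.BirchSwinnertonDyer.Rank1Residual.X11b.AcSelmer
  Summit.BirchSwinnertonDyer.BirchSwinnertonDyer.Theorems

namespace Summit.BirchSwinnertonDyer.Rank1Residual.X12.O11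

/-! ## §1 Quadratic descent of `p`-primary torsion along `K_𝔭 = ℚ_p(√−p)` and the local kernel bound -/

section Twist

variable (W : WeierstrassCurve ℚ) [W.IsElliptic] [W.IsGloballyMinimal] (p : ℕ) [Fact p.Prime]

omit [W.IsElliptic] [W.IsGloballyMinimal] [Fact p.Prime] in
/-- Transport: for a `ℚ`-algebra map of fields `e : F → F'`, `#W(F)[p^∞] ≤ #W(F')[p^∞]` and `W(F)[p^∞]`
is finite when `W(F')[p^∞]` is (points map injectively, `Affine.Point.map_injective`).
[cite: SilvermanAEC2009, VII.§1] -/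
theorem finite_primaryComponent_baseChange_of_algHom {F F' : Type} [Field F] [Algebra ℚ F]
    [Field F'] [Algebra ℚ F'] (e : F →ₐ[ℚ] F')
    [Finite (AddCommGroup.primaryComponent (W.baseChange F').toAffine.Point p)] :
    Finite (AddCommGroup.primaryComponent (W.baseChange F).toAffine.Point p) ∧
      Nat.card (AddCommGroup.primaryComponent (W.baseChange F).toAffine.Point p) ≤
        Nat.card (AddCommGroup.primaryComponent (W.baseChange F').toAffine.Point p) := by
  let f : AddCommGroup.primaryComponent (W.baseChange F).toAffine.Point p →
      AddCommGroup.primaryComponent (W.baseChange F').toAffine.Point p := fun P ↦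
    ⟨WeierstrassCurve.Affine.Point.map e (P : (W.baseChange F).toAffine.Point), by
      obtain ⟨n, hn⟩ := (AddCommGroup.mem_primaryComponent).mp P.2
      exact (AddCommGroup.mem_primaryComponent).mpr ⟨n, by rw [← map_nsmul, hn, map_zero]⟩⟩
  have hf : Function.Injective f := by
    intro a b hab
    have h := congrArg (fun Q : AddCommGroup.primaryComponent (W.baseChange F').toAffine.Point p ↦
      (Q : (W.baseChange F').toAffine.Point)) hab
    exact Subtype.ext (WeierstrassCurve.Affine.Point.map_injective (W' := W) e h)
  exact ⟨Finite.of_injective f hf, Nat.card_le_card_of_injective f hf⟩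

/-- **Quadratic descent of `p`-primary torsion along `K_𝔭 = ℚ_p(√−p)`, every odd prime `p`: `W_K(K_𝔭)[p^∞]`
is finite of order `#W(ℚ_p)[p^∞] · #W'(ℚ_p)[p^∞]`.** For `W/ℚ` globally minimal, `K` imaginary quadratic
with `discr K = −p`, `𝔭 ∋ p`, and a globally minimal model `W' = C • W^{(−p)}` of the twist.
(`[K_𝔭 : ℚ_p] = 2` as `−p ∉ ℚ_p²`; Silverman *AEC* Ex. 10.16 on `p`-primary parts for `K_𝔭 / ℚ_v(p) ≅ ℚ_p`,
tree `card_primaryComponent_point_baseChange_quadratic_of_odd'`; both factors finite by the formal group,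
tree `finite_primaryComponent_point_padic`.) The set-up is verbatim that of `noPTorsion_adicCompletion_of_twist`.
[cite: SilvermanAEC2009, Exercise 10.22 (c), Exercise 10.16 and Prop. VII.6.3] -/
theorem finite_primaryComponent_adicCompletion_of_twist (hp2 : p ≠ 2) {K : Type} [Field K]
    [NumberField K] {𝔭 : HeightOneSpectrum (𝓞 K)} {W' : WeierstrassCurve ℚ} [W'.IsElliptic]
    [W'.IsGloballyMinimal] {C : VariableChange ℚ} (hK : IsImaginaryQuadratic K)
    (hdisc : NumberField.discr K = -(p : ℤ)) (h𝔭 : ((p : ℕ) : 𝓞 K) ∈ 𝔭.asIdeal)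
    (hW' : C • W.quadraticTwist (-(p : ℚ)) = W') :
    Finite (AddCommGroup.primaryComponent
        ((W.baseChange K).baseChange (𝔭.adicCompletion K)).toAffine.Point p) ∧
      Nat.card (AddCommGroup.primaryComponent
          ((W.baseChange K).baseChange (𝔭.adicCompletion K)).toAffine.Point p) =
        Nat.card (AddCommGroup.primaryComponent (W.baseChange ℚ_[p]).toAffine.Point p) *
          Nat.card (AddCommGroup.primaryComponent (W'.baseChange ℚ_[p]).toAffine.Point p) := by
  have hp : p.Prime := Fact.out
  -- the local fields `F = ℚ_v(p)` and `L = K_𝔭`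
  haveI : 𝔭.asIdeal.LiesOver (ratPlace p).asIdeal := ⟨by rw [← under_eq_ratPlace_of_mem h𝔭]; rfl⟩
  set F : Type := (ratPlace p).adicCompletion ℚ with hFdef
  set L : Type := 𝔭.adicCompletion K with hLdef
  haveI : CharZero F := charZero_of_injective_algebraMap (algebraMap ℚ F).injective
  haveI : CharZero L := charZero_of_injective_algebraMap (algebraMap K L).injective
  letI : Algebra F L := (adicCompletionMap (K := ℚ) K (ratPlace p) 𝔭).toAlgebra
  obtain ⟨hfin, hle⟩ := finrank_adicCompletion_le_of_liesOver (K := ℚ) K (ratPlace p) 𝔭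
  haveI : FiniteDimensional F L := hfin
  rw [hK.1] at hle
  -- `F ≃ ℚ_p`: finiteness and the orders of `W(F)[p^∞]`, `W'(F)[p^∞]`
  let e : F →+* ℚ_[p] :=
    (Padic.adicCompletionEquiv (𝓞 ℚ) ⟨p, hp⟩).symm.toAlgEquiv.toRingEquiv.toRingHom
  let e' : ℚ_[p] →+* F :=
    (Padic.adicCompletionEquiv (𝓞 ℚ) ⟨p, hp⟩).toAlgEquiv.toRingEquiv.toRingHom
  haveI := finite_primaryComponent_point_padic W p
  haveI := finite_primaryComponent_point_padic W' p
  obtain ⟨hfinF, hleF⟩ := finite_primaryComponent_baseChange_of_algHom W p e.toRatAlgHom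
  obtain ⟨hfinF', hleF'⟩ := finite_primaryComponent_baseChange_of_algHom W' p e.toRatAlgHom
  haveI := hfinF
  haveI := hfinF'
  obtain ⟨-, hgeF⟩ := finite_primaryComponent_baseChange_of_algHom W p e'.toRatAlgHom
  obtain ⟨-, hgeF'⟩ := finite_primaryComponent_baseChange_of_algHom W' p e'.toRatAlgHom
  have hcardF : Nat.card (AddCommGroup.primaryComponent (W.baseChange F).toAffine.Point p) =
      Nat.card (AddCommGroup.primaryComponent (W.baseChange ℚ_[p]).toAffine.Point p) :=
    le_antisymm hleF hgeF
  have hcardF' : Nat.card (AddCommGroup.primaryComponent (W'.baseChange F).toAffine.Point p) =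
      Nat.card (AddCommGroup.primaryComponent (W'.baseChange ℚ_[p]).toAffine.Point p) :=
    le_antisymm hleF' hgeF'
  -- `√−p ∈ L`, not in `F`
  obtain ⟨θ₁, -, hθ₁sq⟩ := exists_sq_eq_discr_not_mem_range K hK.1
  rw [hdisc] at hθ₁sq
  simp only [Int.cast_neg, Int.cast_natCast, map_neg, map_natCast] at hθ₁sq
  set θ : L := algebraMap K L θ₁ with hθdef
  have hθsq : θ ^ 2 = algebraMap F L (-(p : F)) := by
    rw [map_neg, map_natCast, hθdef, ← map_pow, hθ₁sq, map_neg, map_natCast]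
  have hθ : θ ∉ Set.range (algebraMap F L) := by
    rintro ⟨x, hx⟩
    have hx2 : x ^ 2 = -(p : F) :=
      (algebraMap F L).injective (by rw [map_pow, hx, hθsq, map_neg, map_natCast])
    apply RamifiedSevenEllipticUnits.not_sq_eq_neg_prime_padic p (e x)
    rw [← map_pow, hx2, map_neg, map_natCast]
  -- `[L : F] = 2`
  have h2 : Module.finrank F L = 2 := by
    have hle' : Module.finrank F L ≤ 2 := hle
    have hpos : 0 < Module.finrank F L := Module.finrank_pos
    have hne1 : Module.finrank F L ≠ 1 := by
      intro h1
      have hbot : (⊥ : Subalgebra F L) = ⊤ := Subalgebra.bot_eq_top_iff_finrank_eq_one.mpr h1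
      apply hθ
      have hmem : θ ∈ (⊥ : Subalgebra F L) := by rw [hbot]; exact Algebra.mem_top
      rwa [Algebra.mem_bot] at hmem
    omega
  -- the quadratic descent of `p`-primary torsion: `#E(L)[p^∞] = #W(F)[p^∞] · #W'(F)[p^∞]`
  have hWd : ∃ D : VariableChange F,
      D • (W.baseChange F).quadraticTwist (-(p : F)) = W'.baseChange F := by
    refine ⟨C.map (algebraMap ℚ F), ?_⟩
    have hpF0 : (-(p : F)) = algebraMap ℚ F (-(p : ℚ)) := by rw [map_neg, map_natCast]
    rw [hpF0, baseChange, baseChange, ← map_quadraticTwist, map_variableChange, hW']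
  have hKL : (W.baseChange K).baseChange L = W.baseChange L :=
    W.map_baseChange (algebraMap K L).toRatAlgHom
  have hFL : (W.baseChange F).baseChange L = W.baseChange L :=
    W.map_baseChange (algebraMap F L).toRatAlgHom
  have hmodel : ∃ D : VariableChange L,
      D • (W.baseChange F).baseChange L = (W.baseChange K).baseChange L :=
    ⟨1, by rw [one_smul, hFL, hKL]⟩
  have key := card_primaryComponent_point_baseChange_quadratic_of_odd' (W.baseChange F) h2 hθ hθsq
    hWd hmodel p hp2
  rw [hcardF, hcardF'] at key
  refine ⟨?_, key⟩
  -- finiteness: the right-hand side is positive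
  apply Nat.finite_of_card_ne_zero
  rw [key]
  exact mul_ne_zero (Nat.card_pos (α := AddCommGroup.primaryComponent
      (W.baseChange ℚ_[p]).toAffine.Point p)).ne'
    (Nat.card_pos (α := AddCommGroup.primaryComponent (W'.baseChange ℚ_[p]).toAffine.Point p)).ne'

/-- **The local kernel at `𝔭` is finite, `#ker r_𝔭 ≤ #W(ℚ_p)[p^∞] · #W'(ℚ_p)[p^∞]`**, for every
`ℤ_p`-extension `κ` of `K` (Greenberg's Lemma 3.3 in kernel form, tree
`AcSelmer.natCard_localKer_le_natCard_primaryComponent`: `#ker r_v ≤ #E(K_v)[p^∞]` at every place, no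
hypothesis on `κ` or on the reduction; then §1's quadratic descent). [cite: GreenbergLNM1716, §3 Lemma 3.3 and its proof (pp. 73–75)]
[cite: SilvermanAEC2009, Exercise 10.22 (c) and Exercise 10.16] -/
theorem finite_localKer_and_natCard_le_of_twist (hp2 : p ≠ 2) {K : Type} [Field K]
    [NumberField K] {𝔭 : HeightOneSpectrum (𝓞 K)} {W' : WeierstrassCurve ℚ} [W'.IsElliptic]
    [W'.IsGloballyMinimal] {C : VariableChange ℚ} (hK : IsImaginaryQuadratic K)
    (hdisc : NumberField.discr K = -(p : ℤ)) (h𝔭 : ((p : ℕ) : 𝓞 K) ∈ 𝔭.asIdeal)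
    (hW' : C • W.quadraticTwist (-(p : ℚ)) = W') (κ : ZpExtension K p) :
    Finite (localKer κ.kerSubgroup ((W.baseChange K).geomPrimaryTorsion p) 𝔭) ∧
      Nat.card (localKer κ.kerSubgroup ((W.baseChange K).geomPrimaryTorsion p) 𝔭) ≤
        Nat.card (AddCommGroup.primaryComponent (W.baseChange ℚ_[p]).toAffine.Point p) *
          Nat.card (AddCommGroup.primaryComponent (W'.baseChange ℚ_[p]).toAffine.Point p) := by
  haveI hEK : (W.baseChange K).IsElliptic := by rw [baseChange]; infer_instance
  obtain ⟨hfinv, hcard⟩ := finite_primaryComponent_adicCompletion_of_twist W p hp2 hK hdisc h𝔭 hW'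
  haveI := hfinv
  obtain ⟨hfinK, hK'⟩ := natCard_localKer_le_natCard_primaryComponent (W.baseChange K) p κ 𝔭
  exact ⟨hfinK, hK'.trans hcard.le⟩

end Twist

/-! ## §2 At a `3`-frame: the discharger of ty2's binder `hfin𝔭` and the bound -/

section FrameThree

variable (W : WeierstrassCurve ℚ) [W.IsElliptic] [W.IsGloballyMinimal]
  {K : Type} [Field K] [NumberField K] {𝔭 : HeightOneSpectrum (𝓞 K)}
  {W' : WeierstrassCurve ℚ} [W'.IsElliptic] [W'.IsGloballyMinimal] {C : VariableChange ℚ}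

/-- **`W_K(K_𝔭)[3^∞]` is finite at a `3`-frame, of order `#W(ℚ₃)[3^∞] · #W'(ℚ₃)[3^∞]`** (`K_𝔭 = ℚ₃(√−3)`,
`W' = C • W^{(−3)}`). On regime T this number is `3` or `9` (ty3 PART H `dP`); on regimes N ∪ V it is `1`.
[cite: SilvermanAEC2009, Exercise 10.22 (c), Exercise 10.16 and Prop. VII.6.3] -/
theorem finite_primaryComponent_adicCompletion_three_of_isFrameThree (hF : IsFrameThree W K 𝔭 W' C) :
    Finite (AddCommGroup.primaryComponent
        ((W.baseChange K).baseChange (𝔭.adicCompletion K)).toAffine.Point 3) ∧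
      Nat.card (AddCommGroup.primaryComponent
          ((W.baseChange K).baseChange (𝔭.adicCompletion K)).toAffine.Point 3) =
        Nat.card (AddCommGroup.primaryComponent (W.baseChange ℚ_[3]).toAffine.Point 3) *
          Nat.card (AddCommGroup.primaryComponent (W'.baseChange ℚ_[3]).toAffine.Point 3) :=
  finite_primaryComponent_adicCompletion_of_twist W 3 (by decide) (C := C) hF.2.2.1
    (by rw [hF.discr_eq]; norm_num) hF.2.2.2.2.1 (by simpa using hF.twist_eq)

/-- **THE DISCHARGER of ty2's binder `hfin𝔭`**: at every `3`-frame `IsFrameThree W K 𝔭 W' C` and for every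
`ℤ₃`-extension `κ` of `K` (anticyclotomic or not), Greenberg's local kernel at the ramified prime
`ker r_𝔭 = ker (H¹(K_𝔭, W[3^∞]) → H¹(K_{∞,𝔭}, W[3^∞]))` — `localKer κ.kerSubgroup ((W.baseChange K).geomPrimaryTorsion 3) 𝔭`
verbatim — is FINITE. No (A𝔭)₃, no reduction hypothesis. [cite: GreenbergLNM1716, §3 Lemma 3.3 and its proof (pp. 73–75)] -/
theorem finite_localKer_geomPrimaryTorsion_three_of_isFrameThree (hF : IsFrameThree W K 𝔭 W' C)
    (κ : ZpExtension K 3) :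
    Finite (localKer κ.kerSubgroup ((W.baseChange K).geomPrimaryTorsion 3) 𝔭) :=
  (finite_localKer_and_natCard_le_of_twist W 3 (by decide) (C := C) hF.2.2.1
    (by rw [hF.discr_eq]; norm_num) hF.2.2.2.2.1 (by simpa using hF.twist_eq) κ).1

/-- **The bound of record at a `3`-frame: `#ker r_𝔭 ≤ #W(ℚ₃)[3^∞] · #W'(ℚ₃)[3^∞] = #W_K(K_𝔭)[3^∞]`**
(`= 3` or `9` on regime T). Equality (`#ker r_𝔭 = #B_𝔭^{γ_𝔭}` for the finite `B_𝔭 = W_K(K^ac_{∞,𝔭})[3^∞] ⊆ W[3]`)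
is not claimed here. [cite: GreenbergLNM1716, §3 Lemma 3.3 and its proof (pp. 73–75)]
[cite: Castella2018, proof of Thm. 2.3 (arXiv:1704.06608 p. 6), the factor `#H⁰(K_𝔭, E[p^∞])`] -/
theorem natCard_localKer_three_le_of_isFrameThree (hF : IsFrameThree W K 𝔭 W' C)
    (κ : ZpExtension K 3) :
    Nat.card (localKer κ.kerSubgroup ((W.baseChange K).geomPrimaryTorsion 3) 𝔭) ≤
      Nat.card (AddCommGroup.primaryComponent (W.baseChange ℚ_[3]).toAffine.Point 3) *
        Nat.card (AddCommGroup.primaryComponent (W'.baseChange ℚ_[3]).toAffine.Point 3) :=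
  (finite_localKer_and_natCard_le_of_twist W 3 (by decide) (C := C) hF.2.2.1
    (by rw [hF.discr_eq]; norm_num) hF.2.2.2.2.1 (by simpa using hF.twist_eq) κ).2

/-- The bound in the shape ty2's `controlDefectAtThree` docstring uses: `#ker r_𝔭 ≤ #W_K(K_𝔭)[3^∞]`.
[cite: GreenbergLNM1716, §3 Lemma 3.3 and its proof (pp. 73–75)] -/
theorem natCard_localKer_three_le_natCard_adicCompletion_of_isFrameThree (hF : IsFrameThree W K 𝔭 W' C)
    (κ : ZpExtension K 3) :
    Nat.card (localKer κ.kerSubgroup ((W.baseChange K).geomPrimaryTorsion 3) 𝔭) ≤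
      Nat.card (AddCommGroup.primaryComponent
        ((W.baseChange K).baseChange (𝔭.adicCompletion K)).toAffine.Point 3) := by
  rw [(finite_primaryComponent_adicCompletion_three_of_isFrameThree W hF).2]
  exact natCard_localKer_three_le_of_isFrameThree W hF κ

end FrameThree

end Summit.BirchSwinnertonDyer.Rank1Residual.X12.O11

end
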